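import Summits.BirchSwinnertonDyer.BirchSwinnertonDyer.Theorems.AlignedTransportAtTwoMainConjectureTransportAlignedAtTwoOrdPlusLineOdd
import Summits.BirchSwinnertonDyer.Rank1Residual.X2.EulerFactorAlgebra
import Literature.NumberTheory.EllipticCurves.GreenbergVatsal2000.EulerFactorDepletion
import Literature.NumberTheory.EllipticCurves.BurungaleSkinner2023.RootNumberLambdaParityProofs
import HarnessLib

/-!
# Crux C1 `MainConjectureTransportAlignedAtTwo` (stmt-BirchSwinnertonDyer-22296), line `birth`, residual (R2) `stub_lamLawKilford`, UNEQUAL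
# conductors: ROW (r5) FOR GENERALISED OLD FORMS FROM `μ = 0` ALONE — I. the factor element and the one-prime step on `2`-adic distributions
# (width seat att-p4 g19; `--supports 22296`)

THEOREMS ONLY (no `def`, no `sorry`, no named fact, no instance). BSD is not proved by this; C1 is not closed by this.

Context. In the cross-level capstones (`…KilfordKernelLetterCrossLevelCarrierForms.uniformize_twoForms_ker_iff_of_carrier`, att-p3 g19's level-`lcm`
capstone) every old form `F` of the newform `f` of `W` at the common level `L` needs the row (r5) «some half-class has non-zero image under
`D.jacobiMapForm L F`», i.e. a cycle `y ∈ H₁(X₀(L);ℤ)` with `c·y(F)/2 ∉ Λ_W`. For the one-prime old line `f + q·f(q·)` this was derived from IHARA's lemma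
(`…CrossLevelIhara`, DDT Lemma 4.28 (a)); for att-p3 g19's canonical FACTOR FORMS `F = Σ_m R_m·m·ι_m f`, `R = ∏_{ℓ∈S}([1] + ρ_ℓ[ℓ] + σ_ℓ[ℓ²])` (factor
types `1+V` at level-dividing primes, `1+V²`, `1+V+V²` at additive ones) the needed `ℓ²`-raising Ihara surjectivity (DDT Lemma 4.28 (b) = Wiles Lemma 2.5) is
printed only for ODD residue characteristic. This series of three files replaces Ihara by the `μ = 0` THEOREM: on the measure side the generalised old form is
`(∏_ℓ([1] + ρ_ℓ[ℓ]^* + σ_ℓ[ℓ²]^*))μ_{f,α}` with transform `(∏_ℓ e_ℓ)·L₂(f)`, `e_ℓ = 1 + ρ_ℓ(1+T)^{−f_ℓ} + σ_ℓ(1+T)^{−2f_ℓ}`, and every `e_ℓ` has UNIT CONTENT in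
`𝔽₂⟦T⟧` because `f_ℓ ≠ 0` — so `μ = 0` survives the passage to `F`.

* §1 `hasUnitContent_factorElement` — `e_ℓ` has unit content for every odd prime `ℓ` and ALL integers `ρ, σ` (`ord_T ē_ℓ = mult_1(1 + ρ̄X + σ̄X²)·2^{v₂(f_ℓ)} < ∞`);
  `frobeniusExponent_sq` (`f_{ℓ²} = 2f_ℓ`).
* §2 the one-prime step `μ ↦ μ + ρ[ℓ]^*μ + σ[ℓ²]^*μ` on bounded even distributions on `ℤ₂`: distribution relation, bound, evenness, and transform `ι(e_ℓ)·L_μ`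
  (`distributionTransform_step`).

Siblings: II `…CrossLevelFactorPlusValue` (homology: (K2) for lattice-compatible values, the operator as a fold, integrality); III `…CrossLevelFactorMuCertificate`
(the fold, the two-cusp `μ = 0` certificate, and the row (r5) `exists_jacobiMapForm_factorForm_half_ne_zero`).

References: Mazur–Tate–Teitelbaum 1986 §I.10–I.13 [MazurTateTeitelbaum1986Invent]; Greenberg–Vatsal 2000 §1 (8)–(10), Prop. (2.4) [GreenbergVatsal2000];
Emerton–Pollack–Weston 2006 §3 (3.4)–(3.5) [EmertonPollackWeston2006]; Lang, Cyclotomic Fields I–II, Ch. 4 §2 [LangCyclotomic1990];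
Darmon–Diamond–Taylor 1995 Lemma 4.28 [DarmonDiamondTaylor1995].
-/

noncomputable section

-- justification: the `Summit.BirchSwinnertonDyer.BirchSwinnertonDyer.…` path repeats a component (route-file convention)
set_option linter.dupNamespace false
set_option autoImplicit false

open scoped MatrixGroups ModularForm NumberField Classical
open CongruenceSubgroup Complex WeierstrassCurve IsDedekindDomain PowerSeries
open Literature.NumberTheory.EllipticCurves Literature.NumberTheory.EllipticCurves.ModularForms
open Literature.NumberTheory.EllipticCurves.Greenberg1999 Literature.NumberTheory.EllipticCurves.GreenbergVatsal2000
open Summit.BirchSwinnertonDyer.Rank1Residual.F1Sign2 Summit.BirchSwinnertonDyer.Rank1Residual.X1.MuLambda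
open Summit.BirchSwinnertonDyer.Rank1Residual.X2.EulerFactorAlgebra
open Summit.BirchSwinnertonDyer.BirchSwinnertonDyer.Theorems.AlignedTransportAtTwoSigmaGlue
open Summit.BirchSwinnertonDyer.BirchSwinnertonDyer.Theorems.AlignedTransportAtTwoClosure
open Summit.BirchSwinnertonDyer.BirchSwinnertonDyer.Theorems.AlignedTransportAtTwoSigmaRaw
open Summit.BirchSwinnertonDyer.BirchSwinnertonDyer.Theorems.AlignedTransportAtTwoSymbolParity
open Summit.BirchSwinnertonDyer.BirchSwinnertonDyer.Theorems.AlignedTransportAtTwoOrdPlusLineTools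
open Summit.BirchSwinnertonDyer.BirchSwinnertonDyer.Theorems.AlignedTransportAtTwoOrdPlusLineOdd

namespace Summit.BirchSwinnertonDyer.BirchSwinnertonDyer.Theorems.AlignedTransportAtTwoKilfordKernelLetterCrossLevelFactorMu

/-! ## §1 The factor element `e_ℓ = 1 + ρ(1+T)^{−f_ℓ} + σ(1+T)^{−2f_ℓ}` has unit content -/

/-- **`e_ℓ = 1 + ρ·(1+T)^{−f_ℓ} + σ·(1+T)^{−2f_ℓ} ∈ Λ = ℤ₂⟦T⟧` has unit content** (`μ(e_ℓ) = 0`) for an odd prime `ℓ` and ANY integers `ρ, σ`: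
modulo `2`, `e_ℓ = P̃(Ḡ)` with `P̃ = 1 + ρ̄X + σ̄X² ≠ 0` and `Ḡ = (1+T)^{−f_ℓ} mod 2 = 1 + ε`, `ord_T ε = 2^{v₂(f_ℓ)} < ∞` (`f_ℓ ≠ 0`), so
`ord_T ē_ℓ = mult_1(P̃)·2^{v₂(f_ℓ)}` is finite. (The unit-content half of GV Prop. (2.4) for the operator `[1] + ρ[ℓ] + σ[ℓ²]` instead of the Euler
factor.) [cite: GreenbergVatsal2000, §1 p. 9 and §2 Prop. (2.4)] -/
theorem hasUnitContent_factorElement {ℓ : ℕ} (hℓ : ℓ.Prime) (hℓ2 : ℓ ≠ 2) (ρ σ : ℤ) :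
    HasUnitContent ((1 : IwasawaAlgebra 2) +
      (ρ : IwasawaAlgebra 2) * PowerSeries.binomialSeries ℤ_[2] (-(frobeniusExponent 2 (ℓ : ℤ_[2]))) +
      (σ : IwasawaAlgebra 2) * PowerSeries.binomialSeries ℤ_[2] (-(frobeniusExponent 2 (ℓ : ℤ_[2]))) ^ 2) := by
  rw [hasUnitContent_iff_map_toZMod_ne_zero]
  have hcop : (2 : ℕ).Coprime ℓ := (Nat.coprime_primes Nat.prime_two hℓ).mpr hℓ2.symm
  have h1 : 1 < ℓ := hℓ.one_lt
  set G := PowerSeries.map (PadicInt.toZMod (p := 2))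
    (PowerSeries.binomialSeries ℤ_[2] (-(frobeniusExponent 2 (ℓ : ℤ_[2])))) with hG
  have hG0 : PowerSeries.constantCoeff G = 1 := by
    rw [hG, ← PowerSeries.coeff_zero_eq_constantCoeff_apply, PowerSeries.coeff_map,
      PowerSeries.binomialSeries_coeff, Ring.choose_zero_right, one_smul, map_one]
  have hε0 : PowerSeries.constantCoeff (G - 1) = 0 := by rw [map_sub, hG0, map_one, sub_self]
  have hfin : (G - 1).order ≠ ⊤ := by
    rw [hG, order_map_binomialSeries_sub_one 2 (neg_ne_zero.mpr (frobeniusExponent_natCast_ne_zero hcop h1))]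
    exact_mod_cast ENat.coe_ne_top _
  set P : Polynomial (ZMod 2) := Polynomial.C 1 + Polynomial.C ((ρ : ℤ) : ZMod 2) * Polynomial.X +
    Polynomial.C ((σ : ℤ) : ZMod 2) * Polynomial.X ^ 2 with hP
  have hP0 : P ≠ 0 := by
    intro h
    have h0 := congrArg (fun Q : Polynomial (ZMod 2) ↦ Q.coeff 0) h
    simp [hP] at h0
  have hC1 : PowerSeries.C (1 : ZMod 2) + (G - 1) = G := by rw [map_one, add_sub_cancel]
  have heval : PowerSeries.map (PadicInt.toZMod (p := 2)) ((1 : IwasawaAlgebra 2) +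
      (ρ : IwasawaAlgebra 2) * PowerSeries.binomialSeries ℤ_[2] (-(frobeniusExponent 2 (ℓ : ℤ_[2]))) +
      (σ : IwasawaAlgebra 2) * PowerSeries.binomialSeries ℤ_[2] (-(frobeniusExponent 2 (ℓ : ℤ_[2]))) ^ 2) =
      Polynomial.aeval (PowerSeries.C (1 : ZMod 2) + (G - 1)) P := by
    rw [hC1, hP]
    simp only [map_add, map_mul, map_pow, map_one, map_intCast, Polynomial.aeval_X, ← hG]
  intro h
  have hord := order_aeval_C_add hP0 (1 : ZMod 2) hε0
  rw [← heval, h, PowerSeries.order_zero] at hord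
  exact WithTop.mul_ne_top (ENat.coe_ne_top _) hfin hord.symm


/-! ## §2 The one-prime step `μ ↦ μ + ρ[ℓ]^*μ + σ[ℓ²]^*μ` on bounded even distributions on `ℤ₂` -/

section Step

variable {μ : (n : ℕ) → ZMod (2 ^ n) → ℚ_[2]}

/-- Pointwise unfolding of the step. [folklore] -/
theorem step_apply (ℓ : ℕ) (ρ σ : ℤ) (n : ℕ) (a : ZMod (2 ^ n)) :
    (μ + (ρ : ℚ_[2]) • codilate ℓ μ + (σ : ℚ_[2]) • codilate (ℓ ^ 2) μ) n a =
      μ n a + (ρ : ℚ_[2]) * μ n (a * (ℓ : ZMod (2 ^ n))) + (σ : ℚ_[2]) * μ n (a * ((ℓ ^ 2 : ℕ) : ZMod (2 ^ n))) := by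
  simp only [Pi.add_apply, Pi.smul_apply, smul_eq_mul, codilate_apply]

/-- **The step preserves the distribution relation** (`ℓ` odd; each pull-back `[ℓ^i]^*` does, `codilate_distribution`).
[cite: LangCyclotomic1990, Ch. 4 §2 (PDF pp. 80–82)] -/
theorem step_distribution {ℓ : ℕ} (hℓ : (2 : ℕ).Coprime ℓ) (ρ σ : ℤ)
    (hμ : ∀ (n : ℕ) (a : ZMod (2 ^ n)),
      ∑ b ∈ Finset.univ.filter (fun b : ZMod (2 ^ (n + 1)) ↦
        ZMod.castHom (pow_dvd_pow 2 n.le_succ) (ZMod (2 ^ n)) b = a), μ (n + 1) b = μ n a)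
    (n : ℕ) (a : ZMod (2 ^ n)) :
    ∑ b ∈ Finset.univ.filter (fun b : ZMod (2 ^ (n + 1)) ↦
        ZMod.castHom (pow_dvd_pow 2 n.le_succ) (ZMod (2 ^ n)) b = a),
        (μ + (ρ : ℚ_[2]) • codilate ℓ μ + (σ : ℚ_[2]) • codilate (ℓ ^ 2) μ) (n + 1) b =
      (μ + (ρ : ℚ_[2]) • codilate ℓ μ + (σ : ℚ_[2]) • codilate (ℓ ^ 2) μ) n a := by
  simp only [Pi.add_apply, Pi.smul_apply, smul_eq_mul]
  rw [Finset.sum_add_distrib, Finset.sum_add_distrib, ← Finset.mul_sum, ← Finset.mul_sum, hμ n a,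
    codilate_distribution hℓ hμ n a, codilate_distribution (Nat.Coprime.pow_right 2 hℓ) hμ n a]

/-- **The step preserves bounds** (integer weights, ultrametric inequality). [folklore] -/
theorem norm_step_le (ℓ : ℕ) (ρ σ : ℤ) {C : ℝ} (hC : ∀ (n : ℕ) (a : ZMod (2 ^ n)), ‖μ n a‖ ≤ C) (n : ℕ) (a : ZMod (2 ^ n)) :
    ‖(μ + (ρ : ℚ_[2]) • codilate ℓ μ + (σ : ℚ_[2]) • codilate (ℓ ^ 2) μ) n a‖ ≤ C := by
  have hC0 : 0 ≤ C := (norm_nonneg _).trans (hC 0 0)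
  have hint : ∀ (z : ℤ) (x : ℚ_[2]), ‖x‖ ≤ C → ‖(z : ℚ_[2]) * x‖ ≤ C := fun z x hx ↦ by
    rw [norm_mul]
    calc _ ≤ 1 * C := mul_le_mul (Padic.norm_int_le_one z) hx (norm_nonneg _) zero_le_one
      _ = C := one_mul C
  rw [step_apply]
  refine (Padic.nonarchimedean _ _).trans (max_le ((Padic.nonarchimedean _ _).trans (max_le (hC _ _) ?_)) ?_)
  · exact hint ρ _ (hC _ _)
  · exact hint σ _ (hC _ _)

/-- **The step preserves evenness** (`codilate_neg`). [folklore] -/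
theorem step_neg (ℓ : ℕ) (ρ σ : ℤ) (hμ : ∀ (n : ℕ) (a : ZMod (2 ^ n)), μ n (-a) = μ n a) (n : ℕ) (a : ZMod (2 ^ n)) :
    (μ + (ρ : ℚ_[2]) • codilate ℓ μ + (σ : ℚ_[2]) • codilate (ℓ ^ 2) μ) n (-a) =
      (μ + (ρ : ℚ_[2]) • codilate ℓ μ + (σ : ℚ_[2]) • codilate (ℓ ^ 2) μ) n a := by
  rw [step_apply, step_apply, neg_mul, neg_mul, hμ, hμ, hμ]

/-- `f_{ℓ²} = 2·f_ℓ` for the Greenberg–Vatsal exponent of an odd `ℓ` (`ell` is a homomorphism). [folklore] -/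
theorem frobeniusExponent_sq {ℓ : ℕ} (hℓ : (2 : ℕ).Coprime ℓ) :
    frobeniusExponent 2 (((ℓ ^ 2 : ℕ) : ℤ_[2])) = 2 * frobeniusExponent 2 (ℓ : ℤ_[2]) := by
  have hu : IsUnit ((ℓ : ℕ) : ℤ_[2]) := isUnit_natCast_of_coprime hℓ
  have hu2 : IsUnit (((ℓ ^ 2 : ℕ) : ℤ_[2])) := by rw [Nat.cast_pow]; exact hu.pow 2
  rw [frobeniusExponent_of_isUnit hu2, frobeniusExponent_of_isUnit hu, two_mul, ← CyclotomicZp.ell_mul]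
  congr 1
  exact Units.ext (by simp [pow_two])

/-- **The transform of the step is `ι(e_ℓ)·L_μ`**, `e_ℓ = 1 + ρ(1+T)^{−f_ℓ} + σ(1+T)^{−2f_ℓ}`: `[ℓ^i]^*` multiplies the transform by `(1+T)^{−i f_ℓ}`
(`distributionTransform_codilate`) and the transform is linear (`distributionTransform_finset_sum_smul`).
[cite: LangCyclotomic1990, Ch. 4 §2, Meas 1 and §1 Example 1 (PDF pp. 79–81)] [cite: GreenbergVatsal2000, §1 pp. 8–9 (displays (8)–(10))] -/
theorem distributionTransform_step {ℓ : ℕ} (hℓ : (2 : ℕ).Coprime ℓ) (ρ σ : ℤ)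
    (hμ : ∀ (n : ℕ) (a : ZMod (2 ^ n)),
      ∑ b ∈ Finset.univ.filter (fun b : ZMod (2 ^ (n + 1)) ↦
        ZMod.castHom (pow_dvd_pow 2 n.le_succ) (ZMod (2 ^ n)) b = a), μ (n + 1) b = μ n a)
    {C : ℝ} (hC : ∀ (n : ℕ) (a : ZMod (2 ^ n)), ‖μ n a‖ ≤ C) :
    distributionTransform (μ + (ρ : ℚ_[2]) • codilate ℓ μ + (σ : ℚ_[2]) • codilate (ℓ ^ 2) μ) =
      iwasawaToPowerSeries 2 ((1 : IwasawaAlgebra 2) +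
        (ρ : IwasawaAlgebra 2) * PowerSeries.binomialSeries ℤ_[2] (-(frobeniusExponent 2 (ℓ : ℤ_[2]))) +
        (σ : IwasawaAlgebra 2) * PowerSeries.binomialSeries ℤ_[2] (-(frobeniusExponent 2 (ℓ : ℤ_[2]))) ^ 2) *
      distributionTransform μ := by
  have hℓ' : ℓ.Coprime 2 := hℓ.symm
  -- the transforms of the two pull-backs
  have hcod₁ : distributionTransform (codilate ℓ μ) = PowerSeries.binomialSeries ℚ_[2] (-(frobeniusExponent 2 (ℓ : ℤ_[2]))) * distributionTransform μ := by
    obtain ⟨teich, hteich⟩ := exists_teichmuller_frobeniusExponent (p := 2) (ℓ := ℓ) hℓ'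
    exact distributionTransform_codilate hteich hμ hC
  have hcod₂ : distributionTransform (codilate (ℓ ^ 2) μ) = PowerSeries.binomialSeries ℚ_[2] (-(frobeniusExponent 2 (ℓ : ℤ_[2]))) ^ 2 * distributionTransform μ := by
    obtain ⟨teich, hteich⟩ := exists_teichmuller_frobeniusExponent (p := 2) (ℓ := ℓ ^ 2) (Nat.Coprime.pow_left 2 hℓ')
    rw [frobeniusExponent_sq hℓ] at hteich
    rw [distributionTransform_codilate hteich hμ hC, pow_two, ← PowerSeries.binomialSeries_add, two_mul, neg_add]
  -- linearity over the three terms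
  have hsum : (μ + (ρ : ℚ_[2]) • codilate ℓ μ + (σ : ℚ_[2]) • codilate (ℓ ^ 2) μ) =
      ∑ i : Fin 3, (![(1 : ℚ_[2]), (ρ : ℚ_[2]), (σ : ℚ_[2])] i) • (![μ, codilate ℓ μ, codilate (ℓ ^ 2) μ] i) := by
    rw [Fin.sum_univ_three]
    simp only [Matrix.cons_val_zero, Matrix.cons_val_one, Matrix.cons_val_two, Matrix.head_cons, Matrix.tail_cons, one_smul]
  have hlin := distributionTransform_finset_sum_smul (Finset.univ : Finset (Fin 3))
    (![(1 : ℚ_[2]), (ρ : ℚ_[2]), (σ : ℚ_[2])]) (![μ, codilate ℓ μ, codilate (ℓ ^ 2) μ])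
    (fun i _ ↦ by
      fin_cases i
      · exact hμ
      · exact codilate_distribution hℓ hμ
      · exact codilate_distribution (Nat.Coprime.pow_right 2 hℓ) hμ)
    (fun i _ ↦ by
      fin_cases i
      · exact ⟨C, hC⟩
      · exact ⟨C, norm_codilate_le _ hC⟩
      · exact ⟨C, norm_codilate_le _ hC⟩)
  rw [hsum, hlin, Fin.sum_univ_three]
  simp only [Matrix.cons_val_zero, Matrix.cons_val_one, Matrix.cons_val_two, Matrix.head_cons, Matrix.tail_cons]
  rw [hcod₁, hcod₂]
  simp only [map_add, map_mul, map_pow, map_one, map_intCast, BurungaleSkinner2023.iwasawaToPowerSeries_binomialSeries, one_mul]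
  ring

end Step


end Summit.BirchSwinnertonDyer.BirchSwinnertonDyer.Theorems.AlignedTransportAtTwoKilfordKernelLetterCrossLevelFactorMu

end
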